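import Literature.Topology.FourManifolds.GompfTwistConjTransfer
import Literature.Topology.FourManifolds.GompfRadialStraightening
import Literature.Topology.FourManifolds.FishtailEndModel
import HarnessLib

/-!
# F from fishtail twisting data in the shear model `X_𝔏` (Gompf's Theorem 2.1, adapter)

Final assembly of this seat's reduction of the framed form of R. Gompf, *More Cappell–Shaneson spheres
are standard*, Algebr. Geom. Topol. 10 (2010), Theorem 2.1 (the named fact
`Literature.Topology.FourManifolds.gompf2010_framedTwist`, **F**) to the one remaining geometric
input, in the coordinates in which that input is being built (`FishtailEndModel.lean`,
`FishtailSection.lean`, `FishtailFace.lean`, …): the straightened shear model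
`modelSphere = X_𝔏` surgered (`GompfShearModel.lean`), its product tube of radius
`ε₀ = modelStraightening.prodRad`, the fibre sliver `{1} × farSupport τ` of the second cylinder, and
the twist across it by the **rotation of the third coordinate**
`δ_rot (z₁, z₂, z₃) = (z₁, z₂, z₃ e^{i f(arg z₂)})`, `f = farLift τ`
(`Literature.Topology.FourManifolds.rotDehn` — for `𝔏 ≃ Λ : z₃ ↦ z₁ z₃` Gompf's Dehn twist "parallel to
`φ(α) - α`" is in the direction `e₃`). Given such data for every thickness `r` of the tube about `α`
(hypothesis `hdata` of `Literature.Topology.FourManifolds.gompf2010_framedTwist_of_shearModel`), F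
follows:

1. **radius reduction** (`exists_twistingDiffeo_radius`): conjugating by the compactly supported
   radial contraction `torusContract` (the tree's `contractDiffeo` pushed to `T³`), twisting data at
   the radius `ε₀` become twisting data at any smaller radius `ε` (`GompfTwistConjTransfer.lean`);
2. **conjugation by `C`** (`exists_twistingDiffeo_shearC`): `h_C = C ∘ F₁`, the monodromy of the
   radial straightening of `C = shearC` along the shear path `cPath`, is the identity near `1` and
   `C` off a ball; it conjugates `𝔏` to `C 𝔏 C⁻¹ = conjModelMonodromy` (`GompfShearConj.lean`: equal to
   `tubeShear` on `axisTube 1`) and `δ_rot` to Gompf's `δ = farDehn`, preserving `axisTube r` and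
   `farSupport τ`;
3. `gompf2010_framedTwist_of_conjModel` (`GompfShearConj.lean`), i.e. the locality transfer to every
   `B` in standard form via `GompfTubeStraightening.lean` and the framed row-move chain.

Everything here is proved; no named facts are introduced.

## References

* R. E. Gompf, *More Cappell–Shaneson spheres are standard*, Algebr. Geom. Topol. 10 (2010)
  1665–1681: Thm 2.1 and its proof, Lemma 2.2, §3 ¶1, §4 ¶3. [GompfAGT2010]
* M. W. Hirsch, *Differential Topology*, GTM 33 (1976), Ch. 8 §1. [Hirsch1976]
-/

open scoped Manifold ContDiff Topology Real
open Set Function Metric Complex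

noncomputable section

namespace Literature.Topology.FourManifolds

/-- Local notation: `𝔼 n` is the model Euclidean space `EuclideanSpace ℝ (Fin n)`. -/
local notation "𝔼 " n:arg => EuclideanSpace ℝ (Fin n)

/-- Local notation: `𝕊 n` is the unit sphere in `EuclideanSpace ℝ (Fin (n + 1))`. -/
local notation "𝕊 " n:arg => (Metric.sphere (0 : EuclideanSpace ℝ (Fin (n + 1))) 1)

/-- Local notation: the model with corners `𝓣 = (𝓡 1).prod ((𝓡 1).prod (𝓡 1))` of `ThreeTorus`. -/
local notation "𝓣" =>
  (ModelWithCorners.prod (𝓡 1) (ModelWithCorners.prod (𝓡 1) (𝓡 1)))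

/-! ### The rotation twist `δ_rot` of the third coordinate -/

section Rot

variable {τ : ℝ} (hτ : 0 < τ) (hτ' : τ < π / 2)

/-- **Gompf's Dehn twist for the shear model**: `δ_rot (z₁, z₂, z₃) = (z₁, z₂, z₃ e^{i f(arg z₂)})`,
`f = farLift τ` — a twist along the tori `{z₂ = const}` in the direction `e₃ = Λ α - α` (for the
shear `Λ : z₃ ↦ z₁ z₃` the circle `Λ(α)` is the diagonal of the torus `T = ⟨e₁, e₃⟩`), supported in
the far collar `farSupport τ`. [cite: GompfAGT2010, §2 (definition of δ after Thm 2.1: the Dehn twist along T parallel to φ(α) - α)] -/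
def rotDehn : ThreeTorus ≃ₘ⟮𝓣, 𝓣⟯ ThreeTorus :=
  shearTwistDiffeo (circleMapOfLift (farLift τ))
    (contMDiff_circleMapOfLift (k := 1) (contDiff_farLift hτ hτ') (farLift_periodic τ))

/-- The underlying map of `δ_rot`. [folklore] -/
@[simp] theorem coe_rotDehn : ⇑(rotDehn hτ hτ') = shearTwist (circleMapOfLift (farLift τ)) := rfl

/-- The underlying map of `δ_rot⁻¹`. [folklore] -/
@[simp] theorem coe_rotDehn_symm :
    ⇑(rotDehn hτ hτ').symm = shearTwist fun w ↦ (circleMapOfLift (farLift τ) w)⁻¹ := rfl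

/-- `δ_rot` pointwise. [folklore] -/
theorem rotDehn_apply (z : ThreeTorus) :
    rotDehn hτ hτ' z = (z.1, z.2.1, z.2.2 * circleMapOfLift (farLift τ) z.2.1) := rfl

/-- **`δ_rot` is the identity off the far collar.** [folklore] -/
theorem rotDehn_eq_self {z : ThreeTorus} (hz : z ∉ farSupport τ) : rotDehn hτ hτ' z = z := by
  rw [rotDehn_apply, circleMapOfLift, farLift_arg_eq_zero hτ hτ' hz, Circle.exp_zero, mul_one]

/-- `δ_rot⁻¹` is the identity off the far collar. [folklore] -/
theorem rotDehn_symm_eq_self {z : ThreeTorus} (hz : z ∉ farSupport τ) : (rotDehn hτ hτ').symm z = z := by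
  conv_lhs => rw [← rotDehn_eq_self hτ hτ' hz]
  exact (rotDehn hτ hτ').symm_apply_apply z

/-- `δ_rot` is the identity on small exponentials. [folklore] -/
theorem rotDehn_expT {v : 𝔼 3} (hv : |v 1| < π - τ) : rotDehn hτ hτ' (expT v) = expT v :=
  rotDehn_eq_self hτ hτ' (expT_not_mem_farSupport hτ hv)

/-- **`C δ_rot = δ C`**: conjugating the rotation twist by `C : (z₁, z₂, z₃) ↦ (z₁ z₃⁻¹, z₂, z₃)` gives
Gompf's `δ = farDehn` (direction `e₃ - e₁`). [cite: GompfAGT2010, §3 ¶1 (conjugation)] -/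
theorem torusDiffeomorph_shearC_rotDehn (z : ThreeTorus) :
    torusDiffeomorph shearC (rotDehn hτ hτ' z) = farDehn hτ hτ' (torusDiffeomorph shearC z) := by
  rw [rotDehn_apply, torusDiffeomorph_shearC_apply, torusDiffeomorph_shearC_apply, coe_farDehn, torusTwist]
  ext1
  · show z.1 * (z.2.2 * circleMapOfLift (farLift τ) z.2.1)⁻¹ = z.1 * z.2.2⁻¹ * (circleMapOfLift (farLift τ) z.2.1)⁻¹
    rw [mul_inv_rev, mul_assoc, mul_comm ((circleMapOfLift (farLift τ) z.2.1)⁻¹)]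
  · rfl

/-- `C δ_rot⁻¹ = δ⁻¹ C`. [folklore] -/
theorem torusDiffeomorph_shearC_rotDehn_symm (z : ThreeTorus) :
    torusDiffeomorph shearC ((rotDehn hτ hτ').symm z) = (farDehn hτ hτ').symm (torusDiffeomorph shearC z) := by
  have key : farDehn hτ hτ' (torusDiffeomorph shearC ((rotDehn hτ hτ').symm z)) =
      farDehn hτ hτ' ((farDehn hτ hτ').symm (torusDiffeomorph shearC z)) := by
    rw [Diffeomorph.apply_symm_apply, ← torusDiffeomorph_shearC_rotDehn, Diffeomorph.apply_symm_apply]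
  exact (farDehn hτ hτ').injective key

/-- `C⁻¹ δ⁻¹ = δ_rot⁻¹ C⁻¹`. [folklore] -/
theorem torusDiffeomorph_shearC_symm_farDehn_symm (y : ThreeTorus) :
    (torusDiffeomorph shearC).symm ((farDehn hτ hτ').symm y) =
      (rotDehn hτ hτ').symm ((torusDiffeomorph shearC).symm y) := by
  have key : torusDiffeomorph shearC ((torusDiffeomorph shearC).symm ((farDehn hτ hτ').symm y)) =
      torusDiffeomorph shearC ((rotDehn hτ hτ').symm ((torusDiffeomorph shearC).symm y)) := by
    rw [Diffeomorph.apply_symm_apply, torusDiffeomorph_shearC_rotDehn_symm, Diffeomorph.apply_symm_apply]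
  exact (torusDiffeomorph shearC).injective key

end Rot

/-! ### Commuting self-maps with disjoint "supports" -/

/-- **Two self-maps commute if one fixes pointwise a set off which the other is the identity and
which the other preserves.** [folklore] -/
theorem comp_comm_of_support {α : Type*} {f g : α → α} {E : Set α} (hg : ∀ z ∈ E, g z = z)
    (hginj : Injective g) (hf : ∀ z ∉ E, f z = z) (hfE : ∀ z ∈ E, f z ∈ E) (z : α) :
    f (g z) = g (f z) := by
  by_cases hz : z ∈ E
  · rw [hg z hz, hg _ (hfE z hz)]
  · have hgz : g z ∉ E := fun h ↦ hz (by rwa [← hginj (hg _ h)])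
    rw [hf _ hgz, hf z hz]

/-! ### Pushing a compactly supported diffeomorphism of `ℝ³` to `T³` -/

section Push

/-- **A diffeomorphism of `ℝ³` which is the identity off `B̄(0, R)`, `R < π`, pushed to a
diffeomorphism of `T³`** through exponential coordinates (`torusPush`; the single-map case of
`Diffeotopy.torusExtend`). [cite: Hirsch1976, Ch. 8 §1, Thm. 1.3] -/
def torusDiffeoOfSupport (F : 𝔼 3 ≃ₘ⟮𝓘(ℝ, 𝔼 3), 𝓘(ℝ, 𝔼 3)⟯ 𝔼 3) {R : ℝ} (hR : R < π)
    (hF : ∀ v, R ≤ ‖v‖ → F v = v) : ThreeTorus ≃ₘ⟮𝓣, 𝓣⟯ ThreeTorus :=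
  have hF' : ∀ v, R ≤ ‖v‖ → F.symm v = v := fun v hv ↦ by
    conv_lhs => rw [← hF v hv]
    exact F.symm_apply_apply v
  { toFun := torusPush F
    invFun := torusPush F.symm
    left_inv := torusPush_torusPush hR hF F.injective F.symm_apply_apply
    right_inv := torusPush_torusPush hR hF' F.symm.injective F.apply_symm_apply
    contMDiff_toFun := by
      have h := contMDiff_torusPush_uncurry (Φ := fun _ : ℝ ↦ ⇑F)
        (F.contMDiff.comp contMDiff_snd) hR (fun _ ↦ hF)
      exact h.comp (f := fun z : ThreeTorus ↦ ((0 : ℝ), z)) (contMDiff_const.prodMk contMDiff_id)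
    contMDiff_invFun := by
      have h := contMDiff_torusPush_uncurry (Φ := fun _ : ℝ ↦ ⇑F.symm)
        (F.symm.contMDiff.comp contMDiff_snd) hR (fun _ ↦ hF')
      exact h.comp (f := fun z : ThreeTorus ↦ ((0 : ℝ), z)) (contMDiff_const.prodMk contMDiff_id) }

/-- The pushed diffeomorphism as a function. [folklore] -/
@[simp] theorem coe_torusDiffeoOfSupport (F : 𝔼 3 ≃ₘ⟮𝓘(ℝ, 𝔼 3), 𝓘(ℝ, 𝔼 3)⟯ 𝔼 3) {R : ℝ} (hR : R < π)
    (hF : ∀ v, R ≤ ‖v‖ → F v = v) : ⇑(torusDiffeoOfSupport F hR hF) = torusPush F := rfl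

/-- The inverse of the pushed diffeomorphism as a function. [folklore] -/
@[simp] theorem coe_torusDiffeoOfSupport_symm (F : 𝔼 3 ≃ₘ⟮𝓘(ℝ, 𝔼 3), 𝓘(ℝ, 𝔼 3)⟯ 𝔼 3) {R : ℝ}
    (hR : R < π) (hF : ∀ v, R ≤ ‖v‖ → F v = v) :
    ⇑(torusDiffeoOfSupport F hR hF).symm = torusPush F.symm := rfl

/-- The second coordinate of a push is `e^{i (F (log z))₁}`. [folklore] -/
theorem torusPush_snd_fst (F : 𝔼 3 → 𝔼 3) (z : ThreeTorus) :
    (torusPush F z).2.1 = Circle.exp (F (logT z) 1) := rfl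

/-- The third coordinate of a push is `e^{i (F (log z))₂}`. [folklore] -/
theorem torusPush_snd_snd (F : 𝔼 3 → 𝔼 3) (z : ThreeTorus) :
    (torusPush F z).2.2 = Circle.exp (F (logT z) 2) := rfl

/-- `(log z)₁ = arg z₂`. [folklore] -/
theorem logT_one_eq (z : ThreeTorus) : logT z 1 = arg (z.2.1 : ℂ) := rfl

/-- `(log z)₂ = arg z₃`. [folklore] -/
theorem logT_two_eq (z : ThreeTorus) : logT z 2 = arg (z.2.2 : ℂ) := rfl

/-- **A push by a map preserving the last two coordinates preserves `z₂` and `z₃`.** [folklore] -/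
theorem torusPush_snd_eq {F : 𝔼 3 → 𝔼 3} (h1 : ∀ w, F w 1 = w 1) (h2 : ∀ w, F w 2 = w 2)
    (z : ThreeTorus) : (torusPush F z).2 = z.2 := by
  ext1
  · rw [torusPush_snd_fst, h1, logT_one_eq, Circle.exp_arg]
  · rw [torusPush_snd_snd, h2, logT_two_eq, Circle.exp_arg]

/-- **A push by a map contracting each vector by a factor in `(0, 1]` does not increase `|arg z₂|`
and `|arg z₃|`.** [folklore] -/
theorem abs_arg_torusPush_le {F : 𝔼 3 → 𝔼 3} (hF : ∀ w, ∃ μ : ℝ, 0 < μ ∧ μ ≤ 1 ∧ F w = μ • w)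
    (z : ThreeTorus) :
    |arg ((torusPush F z).2.1 : ℂ)| ≤ |arg (z.2.1 : ℂ)| ∧ |arg ((torusPush F z).2.2 : ℂ)| ≤ |arg (z.2.2 : ℂ)| := by
  obtain ⟨μ, hμ0, hμ1, hFw⟩ := hF (logT z)
  have key : ∀ θ : ℝ, -π < θ → θ ≤ π → |arg ((Circle.exp (μ * θ) : Circle) : ℂ)| ≤ |θ| := by
    intro θ h1 h2
    have hlo : -π < μ * θ := by
      rcases le_or_gt 0 θ with hθ | hθ
      · nlinarith [Real.pi_pos]
      · nlinarith
    have hhi : μ * θ ≤ π := by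
      rcases le_or_gt 0 θ with hθ | hθ
      · nlinarith
      · nlinarith [Real.pi_pos]
    rw [Circle.arg_exp hlo hhi, abs_mul, abs_of_pos hμ0]
    exact mul_le_of_le_one_left (abs_nonneg _) hμ1
  constructor
  · rw [torusPush_snd_fst, hFw, PiLp.smul_apply, smul_eq_mul, logT_one_eq]
    exact key _ (Complex.neg_pi_lt_arg _) (Complex.arg_le_pi _)
  · rw [torusPush_snd_snd, hFw, PiLp.smul_apply, smul_eq_mul, logT_two_eq]
    exact key _ (Complex.neg_pi_lt_arg _) (Complex.arg_le_pi _)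

end Push

/-! ### The radial contraction of `T³` near `1` -/

section Contract

variable {ε₀ : ℝ} (hε₀ : 0 < ε₀) (hε₀' : ε₀ < 1 / 3) {c : ℝ} (hc : 0 < c) (hc1 : c ≤ 1)

/-- The scale `ρ = 2 ε₀ / 7` of the contraction (inner ball `7ρ/2 = ε₀`, outer ball `4ρ = 8ε₀/7`). [folklore] -/
def contractScale (ε₀ : ℝ) : ℝ := 2 * ε₀ / 7

include hε₀ in
/-- `ρ > 0`. [folklore] -/
theorem contractScale_pos : 0 < contractScale ε₀ := by unfold contractScale; positivity

/-- **Each contraction step scales every vector by a factor in `(0, 1]`.** [folklore] -/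
theorem exists_contractStep_eq_smul {ρ : ℝ} (hρ : 0 < ρ) (hc : 0 < c) (hc1 : c ≤ 1) (y : 𝔼 3) :
    ∃ μ : ℝ, 0 < μ ∧ μ ≤ 1 ∧ contractStep hρ c y = μ • y := by
  set a := nthRootOf c (contractSteps (E := 𝔼 3) c) with ha
  have ha0 : 0 < a := nthRootOf_pos _ _
  have ha1 : a ≤ 1 := nthRootOf_le_one hc hc1 _
  set t := cutAt (contractBump (E := 𝔼 3)) ρ y with ht
  have ht0 : 0 ≤ t := (contractBump (E := 𝔼 3)).nonneg
  have ht1 : t ≤ 1 := (contractBump (E := 𝔼 3)).le_one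
  refine ⟨1 + t * (a - 1), by nlinarith, by nlinarith, ?_⟩
  rw [contractStep, coe_straightenDiffeo, straightenFun, ← ht, ← ha,
    show (a • (1 : 𝔼 3 →L[ℝ] 𝔼 3)) y - y = (a - 1) • y by rw [sub_smul, one_smul]; rfl, smul_smul, add_smul,
    one_smul]

/-- **The contraction scales every vector by a factor in `(0, 1]`.** [folklore] -/
theorem exists_contractDiffeo_eq_smul {ρ : ℝ} (hρ : 0 < ρ) (hc : 0 < c) (hc1 : c ≤ 1) (y : 𝔼 3) :
    ∃ μ : ℝ, 0 < μ ∧ μ ≤ 1 ∧ contractDiffeo hρ c y = μ • y := by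
  have key : ∀ n : ℕ, ∃ μ : ℝ, 0 < μ ∧ μ ≤ 1 ∧ (contractStep hρ c)^[n] y = μ • y := by
    intro n
    induction n with
    | zero => exact ⟨1, one_pos, le_rfl, by simp⟩
    | succ n ih =>
      obtain ⟨μ, hμ0, hμ1, hμ⟩ := ih
      obtain ⟨μ', hμ'0, hμ'1, hμ'⟩ := exists_contractStep_eq_smul hρ hc hc1 (μ • y)
      refine ⟨μ' * μ, mul_pos hμ'0 hμ0, mul_le_one₀ hμ'1 hμ0.le hμ1, ?_⟩
      rw [Function.iterate_succ', Function.comp_apply, hμ, hμ', smul_smul]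
  rw [contractDiffeo, coe_iterTrans]
  exact key _

include hε₀' in
/-- `8 ε₀ / 7 < π / 2` (indeed `< 8/21`). [folklore] -/
theorem contract_radius_lt : contractScale ε₀ * 4 < π / 2 := by
  unfold contractScale; linarith [Real.pi_gt_three]

/-- **The radial contraction `h_c` of `T³`**: `expT v ↦ expT (c v)` on `expT (B̄(0, ε₀))`, the identity
off `expT (B(0, 8ε₀/7))` (the tree's `contractDiffeo` pushed to the torus). [cite: Hirsch1976, Ch. 8 §1, Thm. 1.3] -/
def torusContract (hε₀' : ε₀ < 1 / 3) (c : ℝ) : ThreeTorus ≃ₘ⟮𝓣, 𝓣⟯ ThreeTorus :=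
  torusDiffeoOfSupport (contractDiffeo (contractScale_pos hε₀) c)
    ((contract_radius_lt hε₀').trans (by linarith [Real.pi_pos]))
    fun _ hv ↦ contractDiffeo_of_le_norm _ c hv

include hc hc1 in
/-- **`h_c (expT v) = expT (c v)` for `‖v‖ ≤ ε₀`.** [folklore] -/
theorem torusContract_expT {v : 𝔼 3} (hv : ‖v‖ ≤ ε₀) : torusContract hε₀ hε₀' c (expT v) = expT (c • v) := by
  have hπ : ∀ j, |v j| < π := fun j ↦
    lt_of_le_of_lt ((Real.norm_eq_abs _).symm.le.trans (PiLp.norm_apply_le v j))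
      (hv.trans_lt (by linarith [Real.pi_gt_three]))
  show torusPush (contractDiffeo (contractScale_pos hε₀) c) (expT v) = _
  rw [torusPush_expT _ hπ, contractDiffeo_of_norm_le _ hc hc1 (by unfold contractScale; linarith)]

/-- **`h_c` is the identity off `expT (B̄(0, 8ε₀/7))`.** [folklore] -/
theorem torusContract_eq_self {z : ThreeTorus} (hz : z ∉ expT '' closedBall (0 : 𝔼 3) (contractScale ε₀ * 4)) :
    torusContract hε₀ hε₀' c z = z :=
  torusPush_of_not_mem (fun _ hv ↦ contractDiffeo_of_le_norm _ c hv) hz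

/-- `h_c⁻¹` is the identity off `expT (B̄(0, 8ε₀/7))`. [folklore] -/
theorem torusContract_symm_eq_self {z : ThreeTorus} (hz : z ∉ expT '' closedBall (0 : 𝔼 3) (contractScale ε₀ * 4)) :
    (torusContract hε₀ hε₀' c).symm z = z := by
  conv_lhs => rw [← torusContract_eq_self hε₀ hε₀' (c := c) hz]
  exact (torusContract hε₀ hε₀' c).symm_apply_apply z

include hc hc1 in
/-- `h_c` maps `expT (B̄(0, 8ε₀/7))` into itself. [folklore] -/
theorem torusContract_mem {z : ThreeTorus} (hz : z ∈ expT '' closedBall (0 : 𝔼 3) (contractScale ε₀ * 4)) :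
    torusContract hε₀ hε₀' c z ∈ expT '' closedBall (0 : 𝔼 3) (contractScale ε₀ * 4) := by
  obtain ⟨v, hv, rfl⟩ := hz
  have hv' := mem_closedBall_zero_iff.1 hv
  have hπ : ∀ j, |v j| < π := fun j ↦
    lt_of_le_of_lt ((Real.norm_eq_abs _).symm.le.trans (PiLp.norm_apply_le v j))
      (hv'.trans_lt ((contract_radius_lt hε₀').trans (by linarith [Real.pi_pos])))
  obtain ⟨μ, hμ0, hμ1, hμ⟩ := exists_contractDiffeo_eq_smul (contractScale_pos hε₀) hc hc1 v
  refine ⟨μ • v, mem_closedBall_zero_iff.2 ?_, ?_⟩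
  · rw [norm_smul, Real.norm_of_nonneg hμ0.le]
    exact (mul_le_of_le_one_left (norm_nonneg _) hμ1).trans hv'
  · show _ = torusPush (contractDiffeo (contractScale_pos hε₀) c) (expT v)
    rw [torusPush_expT _ hπ, hμ]

include hc hc1 in
/-- **`h_c` does not increase `|arg z₂|`, `|arg z₃|`.** [folklore] -/
theorem abs_arg_torusContract_le (z : ThreeTorus) :
    |arg ((torusContract hε₀ hε₀' c z).2.1 : ℂ)| ≤ |arg (z.2.1 : ℂ)| ∧
      |arg ((torusContract hε₀ hε₀' c z).2.2 : ℂ)| ≤ |arg (z.2.2 : ℂ)| :=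
  abs_arg_torusPush_le (exists_contractDiffeo_eq_smul (contractScale_pos hε₀) hc hc1) z

include hε₀' in
/-- Points of `expT (B̄(0, 8ε₀/7))` have `re z₂ > 0` (so they are off the far collar and off any
set contained in `{re z₂ < 0}`). [folklore] -/
theorem re_pos_of_mem_ball {z : ThreeTorus} (hz : z ∈ expT '' closedBall (0 : 𝔼 3) (contractScale ε₀ * 4)) :
    0 < ((z.2.1 : Circle) : ℂ).re := by
  obtain ⟨v, hv, rfl⟩ := hz
  have hv1 : |v 1| < π / 2 :=
    lt_of_le_of_lt ((Real.norm_eq_abs _).symm.le.trans (PiLp.norm_apply_le v 1))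
      ((mem_closedBall_zero_iff.1 hv).trans_lt (contract_radius_lt hε₀'))
  show 0 < ((Circle.exp (v 1) : Circle) : ℂ).re
  rw [Circle.coe_exp, Complex.exp_ofReal_mul_I_re]
  exact Real.cos_pos_of_mem_Ioo ⟨by linarith [abs_lt.1 hv1], by linarith [abs_lt.1 hv1]⟩

end Contract

/-! ### Neighbourhoods of the sliver inside `{re z₂ < 0}` -/

section Neg

/-- **The part of `V_δ` over `{re z₂ < 0}`** (still a neighbourhood of the far sliver; maps supported
near `1` are the identity there). [folklore] -/
def negVδ (Vδ : TopologicalSpace.Opens (ThreeTorus × ↥mappingTorusPieceTwo)) :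
    TopologicalSpace.Opens (ThreeTorus × ↥mappingTorusPieceTwo) :=
  ⟨{b | b ∈ Vδ ∧ ((b.1.2.1 : Circle) : ℂ).re < 0}, Vδ.2.inter (isOpen_lt
    ((Complex.continuous_re.comp continuous_subtype_val).comp
      (continuous_fst.comp (continuous_snd.comp continuous_fst))) continuous_const)⟩

/-- Membership in `negVδ`. [folklore] -/
@[simp] theorem mem_negVδ {Vδ : TopologicalSpace.Opens (ThreeTorus × ↥mappingTorusPieceTwo)}
    {b : ThreeTorus × ↥mappingTorusPieceTwo} : b ∈ negVδ Vδ ↔ b ∈ Vδ ∧ ((b.1.2.1 : Circle) : ℂ).re < 0 :=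
  Iff.rfl

variable {τ : ℝ} (hτ : 0 < τ) (hτ' : τ < π / 2)

include hτ hτ' in
/-- Points of the far collar have `re z₂ < 0`. [folklore] -/
theorem re_neg_of_mem_farSupport {z : ThreeTorus} (hz : z ∈ farSupport τ) : ((z.2.1 : Circle) : ℂ).re < 0 := by
  have h : Real.cos (π - τ) < 0 := by
    rw [Real.cos_pi_sub]
    exact neg_neg_of_pos (Real.cos_pos_of_mem_Ioo ⟨by linarith, hτ'⟩)
  exact lt_of_le_of_lt hz h

/-- `|arg z₂| < π - τ` puts `z` off the far collar. [folklore] -/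
theorem not_mem_farSupport_of_abs_arg_lt {z : ThreeTorus} (hz : |arg (z.2.1 : ℂ)| < π - τ) (hτ : 0 < τ) :
    z ∉ farSupport τ := by
  intro h
  have h1 : Real.cos (π - τ) < Real.cos (|arg (z.2.1 : ℂ)|) :=
    Real.cos_lt_cos_of_nonneg_of_le_pi (abs_nonneg _) (by linarith) hz
  rw [Real.cos_abs, cos_arg_circle] at h1
  exact absurd h (not_le.2 h1)

include hτ hτ' in
/-- `fibreSliver (farSupport τ) ⊆ negVδ Vδ` when `⊆ Vδ`. [folklore] -/
theorem fibreSliver_subset_negVδ {Vδ : TopologicalSpace.Opens (ThreeTorus × ↥mappingTorusPieceTwo)}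
    (hVS : fibreSliver (farSupport τ) ⊆ Vδ) : fibreSliver (farSupport τ) ⊆ negVδ Vδ :=
  fun _ hb ↦ ⟨hVS hb, re_neg_of_mem_farSupport hτ hτ' ((mem_fibreSliver_iff).1 hb).1⟩

/-- `negVδ Vδ` is stable under the sliver twist of a map preserving `z₂` when `Vδ` is. [folklore] -/
theorem sliverTwist_mem_negVδ {Vδ : TopologicalSpace.Opens (ThreeTorus × ↥mappingTorusPieceTwo)}
    {g : ThreeTorus → ThreeTorus} (hg2 : ∀ y, (g y).2.1 = y.2.1) (hVg : ∀ b ∈ Vδ, sliverTwist g b ∈ Vδ)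
    {b : ThreeTorus × ↥mappingTorusPieceTwo} (hb : b ∈ negVδ Vδ) : sliverTwist g b ∈ negVδ Vδ := by
  refine ⟨hVg b hb.1, ?_⟩
  by_cases h1 : 1 < (b.2 : ℝ)
  · rw [sliverTwist_of_one_lt g h1, hg2]; exact hb.2
  · rw [sliverTwist_of_le_one g (not_lt.1 h1)]; exact hb.2

end Neg

/-! ### Radius reduction -/

section Radius

variable (ψ : ThreeTorus ≃ₘ⟮𝓣, 𝓣⟯ ThreeTorus) {ε₀ ε : ℝ} (hε₀ : 0 < ε₀) (hε₀' : ε₀ < 1 / 3)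
  (hε : 0 < ε) (hεε₀ : ε ≤ ε₀)
  (hψE : ∀ v : 𝔼 3, ‖v‖ ≤ contractScale ε₀ * 4 → ψ (expT v) = expT v)
  {τ : ℝ} (hτ : 0 < τ) (hτ' : τ < π / 2) {η : ℝ} (hη : 0 < η) {r : ℝ} (hεr : ε < r) (hrπ : r ≤ π)
  (Vδ : TopologicalSpace.Opens (ThreeTorus × ↥mappingTorusPieceTwo))
  (hV1 : ∀ b ∈ Vδ, b.1 ≠ 1) (hVη : ∀ b ∈ Vδ, b ∈ bicollarPiece η)

include hε₀' in
/-- `ε₀ ≤ π`. [folklore] -/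
theorem le_pi_of_lt_third : ε₀ ≤ π := by linarith [Real.pi_gt_three]

include hε₀ hψE in
/-- `ψ` is the identity on `expT (B(0, ε₀))`. [folklore] -/
theorem eq_expT_of_fix (v : 𝔼 3) (hv : ‖v‖ < ε₀) : ψ (expT v) = expT v :=
  hψE v (by unfold contractScale; linarith)

include hε₀ hψE hεε₀ in
/-- `ψ` is the identity on `expT (B(0, ε))`. [folklore] -/
theorem eq_expT_of_fix' (v : 𝔼 3) (hv : ‖v‖ < ε) : ψ (expT v) = expT v :=
  hψE v (by unfold contractScale; linarith)

include hV1 in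
/-- `b ∈ negVδ Vδ` has `b.1 ≠ 1`. [folklore] -/
theorem negVδ_fst_ne_one (b : ThreeTorus × ↥mappingTorusPieceTwo) (hb : b ∈ negVδ Vδ) : b.1 ≠ 1 :=
  hV1 b hb.1

set_option maxHeartbeats 800000 in
include hη hεr hVη in
/-- **Radius reduction for twisting data.** Twisting data for `(ψ, δ_rot, farSupport τ, V_δ)` on the
product-framed surgery of radius `ε₀ < 1/3` of `X_ψ` (with `ψ` the identity on `expT (B̄(0, 8ε₀/7))`),
the identity off a closed subset of the surgered `twistNbhd ψ η (axisTube r)`, give twisting data for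
`(ψ, δ_rot, farSupport τ, negVδ V_δ)` at any radius `ε ≤ ε₀`, `ε < r`, again the identity off a closed
subset of the surgered `twistNbhd ψ η (axisTube r)`: conjugate by the radial contraction `h_{ε/ε₀}`
(`exists_twistingDiffeo_conjTransfer`). [cite: GompfAGT2010, Thm 2.1 (proof, last paragraph) and §2 (X^ε_φ independent of the tube)] -/
theorem exists_twistingDiffeo_radius
    (G : ↥((prodTube ψ ε₀ hε₀ (le_pi_of_lt_third hε₀') (eq_expT_of_fix ψ hε₀ hψE)).localOpens
        (prodSliverCompl ψ (isClosed_farSupport τ))) ≃ₘ⟮𝓡 4, 𝓡 4⟯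
      ↥((prodTube ψ ε₀ hε₀ (le_pi_of_lt_third hε₀') (eq_expT_of_fix ψ hε₀ hψE)).localOpens
        (prodSliverCompl ψ (isClosed_farSupport τ))))
    (hG : ∀ (x : ↥((prodTube ψ ε₀ hε₀ (le_pi_of_lt_third hε₀') (eq_expT_of_fix ψ hε₀ hψE)).localOpens
        (prodSliverCompl ψ (isClosed_farSupport τ)))) (b : ↥Vδ),
      (b : ThreeTorus × ↥mappingTorusPieceTwo) ∉ fibreSliver (farSupport τ) →
        (x : prodSurgered ψ ε₀ hε₀ (le_pi_of_lt_third hε₀') (eq_expT_of_fix ψ hε₀ hψE)) =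
          (prodTube ψ ε₀ hε₀ (le_pi_of_lt_third hε₀') (eq_expT_of_fix ψ hε₀ hψE)).glueData.inl
          (opensToComplement (prodTube ψ ε₀ hε₀ (le_pi_of_lt_third hε₀') (eq_expT_of_fix ψ hε₀ hψE))
            (mtGlueData ψ).inr Vδ
            (inr_not_mem_range_secCircle_self ψ hε₀ (le_pi_of_lt_third hε₀') (eq_expT_of_fix ψ hε₀ hψE) Vδ hV1) b) →
          ∃ a' : ↥(prodTube ψ ε₀ hε₀ (le_pi_of_lt_third hε₀') (eq_expT_of_fix ψ hε₀ hψE)).complement,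
            (a' : MTorus ψ) = (mtGlueData ψ).inr (sliverTwist (rotDehn hτ hτ') b) ∧
              (G x : prodSurgered ψ ε₀ hε₀ (le_pi_of_lt_third hε₀') (eq_expT_of_fix ψ hε₀ hψE)) =
                (prodTube ψ ε₀ hε₀ (le_pi_of_lt_third hε₀') (eq_expT_of_fix ψ hε₀ hψE)).glueData.inl a')
    (Ksupp : Set (prodSurgered ψ ε₀ hε₀ (le_pi_of_lt_third hε₀') (eq_expT_of_fix ψ hε₀ hψE)))
    (hKc : IsClosed Ksupp)
    (hKU : Ksupp ⊆ (prodTube ψ ε₀ hε₀ (le_pi_of_lt_third hε₀') (eq_expT_of_fix ψ hε₀ hψE)).localOpens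
      (twistNbhd ψ η (axisTube hrπ) (Diffeotopy.refl 𝓣 ThreeTorus) (Diffeomorph.refl 𝓣 ThreeTorus ∞)))
    (hGK : ∀ x : ↥((prodTube ψ ε₀ hε₀ (le_pi_of_lt_third hε₀') (eq_expT_of_fix ψ hε₀ hψE)).localOpens
        (prodSliverCompl ψ (isClosed_farSupport τ))),
      (x : prodSurgered ψ ε₀ hε₀ (le_pi_of_lt_third hε₀') (eq_expT_of_fix ψ hε₀ hψE)) ∉ Ksupp → G x = x) :
    ∃ (G' : ↥((prodTube ψ ε hε (hεε₀.trans (le_pi_of_lt_third hε₀')) (eq_expT_of_fix' ψ hε₀ hεε₀ hψE)).localOpens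
          (prodSliverCompl ψ (isClosed_farSupport τ))) ≃ₘ⟮𝓡 4, 𝓡 4⟯
        ↥((prodTube ψ ε hε (hεε₀.trans (le_pi_of_lt_third hε₀')) (eq_expT_of_fix' ψ hε₀ hεε₀ hψE)).localOpens
          (prodSliverCompl ψ (isClosed_farSupport τ))))
      (Ksupp' : Set (prodSurgered ψ ε hε (hεε₀.trans (le_pi_of_lt_third hε₀')) (eq_expT_of_fix' ψ hε₀ hεε₀ hψE))),
      IsClosed Ksupp' ∧
      Ksupp' ⊆ (prodTube ψ ε hε (hεε₀.trans (le_pi_of_lt_third hε₀')) (eq_expT_of_fix' ψ hε₀ hεε₀ hψE)).localOpens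
        (twistNbhd ψ η (axisTube hrπ) (Diffeotopy.refl 𝓣 ThreeTorus) (Diffeomorph.refl 𝓣 ThreeTorus ∞)) ∧
      (∀ x : ↥((prodTube ψ ε hε (hεε₀.trans (le_pi_of_lt_third hε₀')) (eq_expT_of_fix' ψ hε₀ hεε₀ hψE)).localOpens
          (prodSliverCompl ψ (isClosed_farSupport τ))),
        (x : prodSurgered ψ ε hε (hεε₀.trans (le_pi_of_lt_third hε₀')) (eq_expT_of_fix' ψ hε₀ hεε₀ hψE)) ∉ Ksupp' →
          G' x = x) ∧
      ∀ (x : ↥((prodTube ψ ε hε (hεε₀.trans (le_pi_of_lt_third hε₀')) (eq_expT_of_fix' ψ hε₀ hεε₀ hψE)).localOpens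
          (prodSliverCompl ψ (isClosed_farSupport τ)))) (b : ↥(negVδ Vδ)),
        (b : ThreeTorus × ↥mappingTorusPieceTwo) ∉ fibreSliver (farSupport τ) →
          (x : prodSurgered ψ ε hε (hεε₀.trans (le_pi_of_lt_third hε₀')) (eq_expT_of_fix' ψ hε₀ hεε₀ hψE)) =
            (prodTube ψ ε hε (hεε₀.trans (le_pi_of_lt_third hε₀')) (eq_expT_of_fix' ψ hε₀ hεε₀ hψE)).glueData.inl
            (opensToComplement (prodTube ψ ε hε (hεε₀.trans (le_pi_of_lt_third hε₀')) (eq_expT_of_fix' ψ hε₀ hεε₀ hψE))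
              (mtGlueData ψ).inr (negVδ Vδ)
              (inr_not_mem_range_secCircle_self ψ hε (hεε₀.trans (le_pi_of_lt_third hε₀'))
                (eq_expT_of_fix' ψ hε₀ hεε₀ hψE) (negVδ Vδ) (negVδ_fst_ne_one Vδ hV1)) b) →
            ∃ a' : ↥(prodTube ψ ε hε (hεε₀.trans (le_pi_of_lt_third hε₀')) (eq_expT_of_fix' ψ hε₀ hεε₀ hψE)).complement,
              (a' : MTorus ψ) = (mtGlueData ψ).inr (sliverTwist (rotDehn hτ hτ') b) ∧
                (G' x : prodSurgered ψ ε hε (hεε₀.trans (le_pi_of_lt_third hε₀')) (eq_expT_of_fix' ψ hε₀ hεε₀ hψE)) =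
                  (prodTube ψ ε hε (hεε₀.trans (le_pi_of_lt_third hε₀')) (eq_expT_of_fix' ψ hε₀ hεε₀ hψE)).glueData.inl a' := by
  -- the contraction and its support
  have hc : 0 < ε / ε₀ := div_pos hε hε₀
  have hc1 : ε / ε₀ ≤ 1 := (div_le_one hε₀).2 hεε₀
  let h : ThreeTorus ≃ₘ⟮𝓣, 𝓣⟯ ThreeTorus := torusContract hε₀ hε₀' (ε / ε₀)
  let E : Set ThreeTorus := expT '' closedBall (0 : 𝔼 3) (contractScale ε₀ * 4)
  have hhE : ∀ z ∉ E, h z = z := fun z hz ↦ torusContract_eq_self hε₀ hε₀' hz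
  have hhEm : ∀ z ∈ E, h z ∈ E := fun z hz ↦ torusContract_mem hε₀ hε₀' hc hc1 hz
  have hψfix : ∀ z ∈ E, ψ z = z := by
    rintro _ ⟨v, hv, rfl⟩
    exact hψE v (mem_closedBall_zero_iff.1 hv)
  have hEfar : ∀ z ∈ E, z ∉ farSupport τ := fun z hz hzS ↦
    absurd (re_neg_of_mem_farSupport hτ hτ' hzS) (not_lt.2 (re_pos_of_mem_ball hε₀' hz).le)
  have hgfix : ∀ z ∈ E, rotDehn hτ hτ' z = z := fun z hz ↦ rotDehn_eq_self hτ hτ' (hEfar z hz)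
  have hconj : ∀ y, h (ψ y) = ψ (h y) := comp_comm_of_support hψfix ψ.injective hhE hhEm
  have hgg' : ∀ y, h (rotDehn hτ hτ' y) = rotDehn hτ hτ' (h y) :=
    comp_comm_of_support hgfix (rotDehn hτ hτ').injective hhE hhEm
  -- tube to tube
  have hh : ∀ w : 𝔼 3, h (expT ((TubeTwist.const ε₀ hε₀ (le_pi_of_lt_third hε₀')).shrink w)) =
      expT ((TubeTwist.const ε hε (hεε₀.trans (le_pi_of_lt_third hε₀'))).shrink w) := by
    intro w
    show torusContract hε₀ hε₀' (ε / ε₀) (expT (OpenPartialHomeomorph.univBall (0 : 𝔼 3) ε₀ w)) =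
      expT (OpenPartialHomeomorph.univBall (0 : 𝔼 3) ε w)
    rw [torusContract_expT hε₀ hε₀' hc hc1 (norm_univBall_zero_lt hε₀ w).le, ← univBall_eq_smul_univBall hε hε₀ w]
  -- the tube `V = axisTube r ∪ h⁻¹ (axisTube r)` on the source side
  let W₀ : TopologicalSpace.Opens ThreeTorus := ⟨h ⁻¹' (axisTube hrπ : Set ThreeTorus), (axisTube hrπ).2.preimage h.continuous⟩
  let V : TopologicalSpace.Opens ThreeTorus := axisTube hrπ ⊔ W₀
  have hVV' : ∀ y ∈ V, h y ∈ axisTube hrπ := by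
    intro y hy
    rcases (TopologicalSpace.Opens.mem_sup.1 hy) with hy | hy
    · have ha := abs_arg_torusContract_le hε₀ hε₀' hc hc1 y
      rw [mem_axisTube_iff] at hy ⊢
      exact ⟨ha.1.trans_lt hy.1, ha.2.trans_lt hy.2⟩
    · exact hy
  have hVε : ∀ v : 𝔼 3, ‖v‖ < ε₀ → expT v ∈ V := by
    intro v hv
    refine TopologicalSpace.Opens.mem_sup.2 (Or.inr ?_)
    show h (expT v) ∈ axisTube hrπ
    show torusContract hε₀ hε₀' (ε / ε₀) (expT v) ∈ axisTube hrπ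
    rw [torusContract_expT hε₀ hε₀' hc hc1 hv.le]
    refine expT_mem_axisTube hrπ ?_
    rw [norm_smul, Real.norm_of_nonneg hc.le]
    calc ε / ε₀ * ‖v‖ ≤ ε / ε₀ * ε₀ := mul_le_mul_of_nonneg_left hv.le hc.le
      _ = ε := div_mul_cancel₀ _ hε₀.ne'
      _ < r := hεr
  -- the sliver set
  have hSS' : ∀ y, y ∈ farSupport τ ↔ h y ∈ farSupport τ := by
    intro y
    constructor
    · intro hy
      rwa [hhE y (fun hyE ↦ hEfar y hyE hy)]
    · intro hy
      by_contra hy'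
      have h1 := abs_arg_lt_of_not_mem hτ hτ' hy'
      have h2 := (abs_arg_torusContract_le hε₀ hε₀' hc hc1 y).1
      exact not_mem_farSupport_of_abs_arg_lt (h2.trans_lt h1) hτ hy
  have hSε : ∀ v : 𝔼 3, ‖v‖ < ε₀ → expT v ∉ farSupport τ := fun v hv ↦
    expT_not_mem_farSupport hτ (lt_of_le_of_lt ((Real.norm_eq_abs _).symm.le.trans (PiLp.norm_apply_le v 1))
      (by linarith [Real.pi_gt_three]))
  have hS'ε : ∀ v : 𝔼 3, ‖v‖ < ε → expT v ∉ farSupport τ := fun v hv ↦ hSε v (hv.trans_le hεε₀)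
  -- `V_δ`
  have hVδ : ∀ b' ∈ negVδ Vδ, (h.symm b'.1, b'.2) ∈ Vδ := by
    intro b' hb'
    have hb'E : b'.1 ∉ E := fun hE ↦ absurd hb'.2 (not_lt.2 (re_pos_of_mem_ball hε₀' hE).le)
    have : h.symm b'.1 = b'.1 := torusContract_symm_eq_self hε₀ hε₀' hb'E
    rw [this]
    exact hb'.1
  have hKU' : Ksupp ⊆ (prodTube ψ ε₀ hε₀ (le_pi_of_lt_third hε₀') (eq_expT_of_fix ψ hε₀ hψE)).localOpens
      (twistNbhd ψ η V (Diffeotopy.refl 𝓣 ThreeTorus) (Diffeomorph.refl 𝓣 ThreeTorus ∞)) :=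
    fun p hp ↦ (prodTube ψ ε₀ hε₀ (le_pi_of_lt_third hε₀') (eq_expT_of_fix ψ hε₀ hψE)).localOpens_mono
      (fun x hx ↦ twistNbhd_mono ψ η (fun y hy ↦ TopologicalSpace.Opens.mem_sup.2 (Or.inl hy)) _ _ hx) (hKU hp)
  exact exists_twistingDiffeo_conjTransfer ψ ψ h hconj hε₀ (le_pi_of_lt_third hε₀') (eq_expT_of_fix ψ hε₀ hψE)
    hε (hεε₀.trans (le_pi_of_lt_third hε₀')) (eq_expT_of_fix' ψ hε₀ hεε₀ hψE) hh hη V (axisTube hrπ) hVV' hVε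
    (rotDehn hτ hτ') (rotDehn hτ hτ') hgg' (isClosed_farSupport τ) (isClosed_farSupport τ) hSS' hSε hS'ε
    Vδ (negVδ Vδ) hV1 (negVδ_fst_ne_one Vδ hV1) hVη hVδ G hG Ksupp hKc hKU' hGK

end Radius

/-! ### The conjugator `h_C = C ∘ F₁` -/

section ShearC

/-- The nilpotent direction `N₀ = !![0, 0, -1; 0, 0, 0; 0, 0, 0]` of the shear path (`N₀² = 0`). [folklore] -/
def cNil : Matrix (Fin 3) (Fin 3) ℝ := !![0, 0, -1; 0, 0, 0; 0, 0, 0]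

/-- `N₀² = 0`. [folklore] -/
theorem cNil_mul_cNil : cNil * cNil = 0 := by
  ext i j; fin_cases i <;> fin_cases j <;> simp [cNil, Matrix.mul_apply, Fin.sum_univ_three]

/-- The real matrix of `C`. [folklore] -/
theorem slRealMatrix_shearC : slRealMatrix shearC = 1 + cNil := by
  ext i j
  fin_cases i <;> fin_cases j <;> simp [slRealMatrix, shearC, cNil]

/-- The real matrix of `C⁻¹`. [folklore] -/
theorem slRealMatrix_shearC_inv : slRealMatrix shearC⁻¹ = 1 - cNil := by
  ext i j
  rw [slRealMatrix, coe_shearC_inv]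
  fin_cases i <;> fin_cases j <;> simp [cNil]

/-- **The shear path `θ ↦ 1 + σ(θ) N₀` from `1` to `C`.** [folklore] -/
def cPath : SmoothMatrixPath (slRealMatrix shearC) where
  toFun θ := 1 + Real.smoothTransition θ • cNil
  inv θ := 1 - Real.smoothTransition θ • cNil
  contDiff_apply i j := by
    simp only [Matrix.add_apply, Matrix.smul_apply, smul_eq_mul]
    exact contDiff_const.add (Real.smoothTransition.contDiff.mul contDiff_const)
  contDiff_inv_apply i j := by
    simp only [Matrix.sub_apply, Matrix.smul_apply, smul_eq_mul]
    exact contDiff_const.sub (Real.smoothTransition.contDiff.mul contDiff_const)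
  mul_inv θ := by
    rw [add_mul, one_mul, mul_sub, mul_one, smul_mul_smul_comm, cNil_mul_cNil, smul_zero, sub_zero]
    abel
  inv_mul θ := by
    rw [sub_mul, one_mul, mul_add, mul_one, smul_mul_smul_comm, cNil_mul_cNil, smul_zero, add_zero]
    abel
  eq_one θ hθ := by rw [Real.smoothTransition.zero_of_nonpos hθ, zero_smul, add_zero]
  eq_self θ hθ := by rw [Real.smoothTransition.one_of_one_le hθ, one_smul, slRealMatrix_shearC]

/-- **`Q(θ) = β_C(1 - θ) C⁻¹ = 1 + (σ(1 - θ) - 1) • (-N₀)`… concretely `Q(θ) v = (v₀ + (1 - σ(1-θ)) v₂, v₁, v₂)`: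
the radial linearization preserves the last two coordinates.** [folklore] -/
theorem mulVecE_reverseInv_cPath (θ : ℝ) (v : 𝔼 3) :
    mulVecE (cPath.reverseInv.toFun θ) v 1 = v 1 ∧ mulVecE (cPath.reverseInv.toFun θ) v 2 = v 2 := by
  rw [SmoothMatrixPath.reverseInv_toFun, slRealMatrix_shearC_inv]
  constructor <;>
    simp [mulVecE_apply, Fin.sum_univ_three, cPath, cNil, Matrix.mul_apply, Matrix.add_apply, Matrix.sub_apply,
      Matrix.one_apply]

/-- The Euclidean stage `Φ₁` of the radial straightening of `C`. [folklore] -/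
abbrev cPhi : 𝔼 3 → 𝔼 3 :=
  radialLinMap cPath.reverseInv (radialRho shearC cPath) (radialL shearC cPath) 1

/-- `Φ₁` preserves the last two coordinates. [folklore] -/
theorem cPhi_apply_one_two (w : 𝔼 3) : cPhi w 1 = w 1 ∧ cPhi w 2 = w 2 :=
  mulVecE_reverseInv_cPath _ w

/-- `Φ₁ = id` off `B(0, π/4)`. [folklore] -/
theorem cPhi_eq_self (v : 𝔼 3) (hv : π / 4 ≤ ‖v‖) : cPhi v = v :=
  radialDiffeotopy_toFun_eq_self shearC cPath 1 v hv

/-- `Φ₁` maps `B̄(0, π/4)` into itself. [folklore] -/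
theorem norm_cPhi_le {v : 𝔼 3} (hv : ‖v‖ ≤ π / 4) : ‖cPhi v‖ ≤ π / 4 := by
  rcases hv.lt_or_eq with hv | hv
  · have h := norm_radialLinMap_lt cPath.reverseInv (radialRho_pos shearC cPath) (le_refl (radialL shearC cPath)) 1
      (v := v) (by rw [radialRho_mul_exp]; exact hv)
    rw [radialRho_mul_exp] at h
    exact h.le
  · rw [cPhi_eq_self v hv.ge, hv]

/-- **The conjugator `h_C := C ∘ F₁`**, the monodromy of the radial straightening of `C` along `cPath`:
the identity near `1`, `C` off a ball. [cite: GompfAGT2010, §3 ¶1 (conjugation) and §4 ¶2 (straightening)] -/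
abbrev hC : ThreeTorus ≃ₘ⟮𝓣, 𝓣⟯ ThreeTorus := (radialStraightening shearC cPath).monodromy

/-- The torus stage `F₁ = push Φ₁`. [folklore] -/
theorem radialStraightening_D_one (z : ThreeTorus) :
    (radialStraightening shearC cPath).D.toFun 1 z = torusPush cPhi z := rfl

/-- `h_C z = C (push Φ₁ z)`. [folklore] -/
theorem hC_apply (z : ThreeTorus) : hC z = torusDiffeomorph shearC (torusPush cPhi z) := rfl

/-- The ball `E_C = expT (B̄(0, π/4))` supporting `F₁`. [folklore] -/
abbrev cBall : Set ThreeTorus := expT '' closedBall (0 : 𝔼 3) (π / 4)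

/-- `push Φ₁ = id` off `E_C`. [folklore] -/
theorem torusPush_cPhi_eq_self {z : ThreeTorus} (hz : z ∉ cBall) : torusPush cPhi z = z :=
  torusPush_of_not_mem cPhi_eq_self hz

/-- `push Φ₁` maps `E_C` into itself. [folklore] -/
theorem torusPush_cPhi_mem {z : ThreeTorus} (hz : z ∈ cBall) : torusPush cPhi z ∈ cBall := by
  obtain ⟨v, hv, rfl⟩ := hz
  have hv' := mem_closedBall_zero_iff.1 hv
  have hπ : ∀ j, |v j| < π := fun j ↦
    lt_of_le_of_lt ((Real.norm_eq_abs _).symm.le.trans (PiLp.norm_apply_le v j))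
      (hv'.trans_lt (by linarith [Real.pi_pos]))
  rw [torusPush_expT _ hπ]
  exact ⟨cPhi v, mem_closedBall_zero_iff.2 (norm_cPhi_le hv'), rfl⟩

/-- `push Φ₁` preserves `z₂` and `z₃`. [folklore] -/
theorem torusPush_cPhi_snd (z : ThreeTorus) : (torusPush cPhi z).2 = z.2 :=
  torusPush_snd_eq (fun w ↦ (cPhi_apply_one_two w).1) (fun w ↦ (cPhi_apply_one_two w).2) z

/-- **`h_C` preserves `z₂` and `z₃`.** [folklore] -/
theorem hC_snd (z : ThreeTorus) : (hC z).2 = z.2 := by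
  rw [hC_apply, torusDiffeomorph_shearC_apply, torusPush_cPhi_snd]

/-- Points of `E_C` have `re z₂ > 0`. [folklore] -/
theorem re_pos_of_mem_cBall {z : ThreeTorus} (hz : z ∈ cBall) : 0 < ((z.2.1 : Circle) : ℂ).re := by
  obtain ⟨v, hv, rfl⟩ := hz
  have hv1 : |v 1| < π / 2 :=
    lt_of_le_of_lt ((Real.norm_eq_abs _).symm.le.trans (PiLp.norm_apply_le v 1))
      ((mem_closedBall_zero_iff.1 hv).trans_lt (by linarith [Real.pi_pos]))
  show 0 < ((Circle.exp (v 1) : Circle) : ℂ).re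
  rw [Circle.coe_exp, Complex.exp_ofReal_mul_I_re]
  exact Real.cos_pos_of_mem_Ioo ⟨by linarith [abs_lt.1 hv1], by linarith [abs_lt.1 hv1]⟩

/-- `𝔏` is the identity on `E_C`. [folklore] -/
theorem modelMonodromy_eq_self_of_mem_cBall {z : ThreeTorus} (hz : z ∈ cBall) : modelMonodromy z = z := by
  obtain ⟨v, hv, rfl⟩ := hz
  exact modelMonodromy_expT v fun i ↦
    lt_of_le_of_lt ((Real.norm_eq_abs _).symm.le.trans (PiLp.norm_apply_le v i))
      ((mem_closedBall_zero_iff.1 hv).trans_lt (by linarith [Real.pi_lt_d2]))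

/-- **`h_C 𝔏 = (C 𝔏 C⁻¹) h_C`.** [cite: GompfAGT2010, §3 ¶1 (conjugation)] -/
theorem hC_conj (y : ThreeTorus) : hC (modelMonodromy y) = conjModelMonodromy (hC y) := by
  rw [hC_apply, hC_apply, comp_comm_of_support (f := torusPush cPhi) (g := ⇑modelMonodromy) (E := cBall)
    (fun z hz ↦ modelMonodromy_eq_self_of_mem_cBall hz) modelMonodromy.injective
    (fun z hz ↦ torusPush_cPhi_eq_self hz) (fun z hz ↦ torusPush_cPhi_mem hz) y]
  exact conjMono_apply_apply _ _ _

variable {τ : ℝ} (hτ : 0 < τ) (hτ' : τ < π / 2)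

/-- `δ_rot` is the identity on `E_C`. [folklore] -/
theorem rotDehn_eq_self_of_mem_cBall {z : ThreeTorus} (hz : z ∈ cBall) : rotDehn hτ hτ' z = z :=
  rotDehn_eq_self hτ hτ' fun hzS ↦ absurd (re_neg_of_mem_farSupport hτ hτ' hzS) (not_lt.2 (re_pos_of_mem_cBall hz).le)

/-- **`h_C δ_rot = δ h_C`.** [cite: GompfAGT2010, §3 ¶1 (conjugation)] -/
theorem hC_rotDehn (y : ThreeTorus) : hC (rotDehn hτ hτ' y) = farDehn hτ hτ' (hC y) := by
  rw [hC_apply, hC_apply, comp_comm_of_support (f := torusPush cPhi) (g := ⇑(rotDehn hτ hτ')) (E := cBall)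
    (fun z hz ↦ rotDehn_eq_self_of_mem_cBall hτ hτ' hz) (rotDehn hτ hτ').injective
    (fun z hz ↦ torusPush_cPhi_eq_self hz) (fun z hz ↦ torusPush_cPhi_mem hz) y]
  exact torusDiffeomorph_shearC_rotDehn hτ hτ' _

/-- `h_C` is the identity on the ball of radius `R_C = radialR C β_C`. [folklore] -/
theorem hC_expT {v : 𝔼 3} (hv : ‖v‖ < radialR shearC cPath) : hC (expT v) = expT v :=
  (radialStraightening shearC cPath).monodromy_expT v fun i ↦
    lt_of_le_of_lt ((Real.norm_eq_abs _).symm.le.trans (PiLp.norm_apply_le v i)) hv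

/-- `h_C⁻¹ y = C⁻¹ y` when `re y₂ < 0`. [folklore] -/
theorem hC_symm_apply_of_re_neg {y : ThreeTorus} (hy : ((y.2.1 : Circle) : ℂ).re < 0) :
    hC.symm y = (torusDiffeomorph shearC).symm y := by
  have h1 : (torusDiffeomorph shearC).symm y ∉ cBall := fun hE ↦ by
    have h2 := re_pos_of_mem_cBall hE
    rw [torusDiffeomorph_shearC_symm_apply] at h2
    exact absurd hy (not_lt.2 h2.le)
  have h3 : hC ((torusDiffeomorph shearC).symm y) = y := by
    rw [hC_apply, torusPush_cPhi_eq_self h1, Diffeomorph.apply_symm_apply]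
  conv_lhs => rw [← h3]
  exact hC.symm_apply_apply _

/-- **`V_δ` read through `C`**: `{b | (C⁻¹ × id) b ∈ V_δ, re b₂ < 0}`. [folklore] -/
def cVδ (Vδ : TopologicalSpace.Opens (ThreeTorus × ↥mappingTorusPieceTwo)) :
    TopologicalSpace.Opens (ThreeTorus × ↥mappingTorusPieceTwo) :=
  ⟨{b | ((torusDiffeomorph shearC).symm b.1, b.2) ∈ Vδ ∧ ((b.1.2.1 : Circle) : ℂ).re < 0},
    (Vδ.2.preimage (((torusDiffeomorph shearC).symm.continuous.comp continuous_fst).prodMk continuous_snd)).inter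
      (isOpen_lt ((Complex.continuous_re.comp continuous_subtype_val).comp
        (continuous_fst.comp (continuous_snd.comp continuous_fst))) continuous_const)⟩

/-- Membership in `cVδ`. [folklore] -/
@[simp] theorem mem_cVδ {Vδ : TopologicalSpace.Opens (ThreeTorus × ↥mappingTorusPieceTwo)}
    {b : ThreeTorus × ↥mappingTorusPieceTwo} :
    b ∈ cVδ Vδ ↔ ((torusDiffeomorph shearC).symm b.1, b.2) ∈ Vδ ∧ ((b.1.2.1 : Circle) : ℂ).re < 0 := Iff.rfl

/-- `C⁻¹` preserves the far collar. [folklore] -/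
theorem mem_farSupport_shearC_symm_iff (y : ThreeTorus) :
    (torusDiffeomorph shearC).symm y ∈ farSupport τ ↔ y ∈ farSupport τ := by
  simp only [farSupport, mem_setOf_eq, torusDiffeomorph_shearC_symm_apply]

include hτ hτ' in
/-- `fibreSliver (farSupport τ) ⊆ cVδ Vδ` when `⊆ Vδ`. [folklore] -/
theorem fibreSliver_subset_cVδ {Vδ : TopologicalSpace.Opens (ThreeTorus × ↥mappingTorusPieceTwo)}
    (hVS : fibreSliver (farSupport τ) ⊆ Vδ) : fibreSliver (farSupport τ) ⊆ cVδ Vδ := by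
  intro b hb
  obtain ⟨hb1, hb2⟩ := (mem_fibreSliver_iff).1 hb
  exact ⟨hVS ((mem_fibreSliver_iff).2 ⟨(mem_farSupport_shearC_symm_iff b.1).2 hb1, hb2⟩),
    re_neg_of_mem_farSupport hτ hτ' hb1⟩

/-- `b ∈ cVδ Vδ` has `b.1 ≠ 1` when `V_δ` misses the fibre through `1`. [folklore] -/
theorem cVδ_fst_ne_one {Vδ : TopologicalSpace.Opens (ThreeTorus × ↥mappingTorusPieceTwo)}
    (hV1 : ∀ b ∈ Vδ, b.1 ≠ 1) (b : ThreeTorus × ↥mappingTorusPieceTwo) (hb : b ∈ cVδ Vδ) : b.1 ≠ 1 := by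
  intro h1
  refine hV1 _ hb.1 ?_
  show (torusDiffeomorph shearC).symm b.1 = 1
  rw [h1, torusDiffeomorph_shearC_symm_apply]
  ext1 <;> simp

/-- `cVδ Vδ ⊆ bicollarPiece η` when `Vδ ⊆`. [folklore] -/
theorem cVδ_subset_bicollar {Vδ : TopologicalSpace.Opens (ThreeTorus × ↥mappingTorusPieceTwo)} {η : ℝ}
    (hVη : ∀ b ∈ Vδ, b ∈ bicollarPiece η) (b : ThreeTorus × ↥mappingTorusPieceTwo) (hb : b ∈ cVδ Vδ) :
    b ∈ bicollarPiece η := by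
  have := hVη _ hb.1
  rw [mem_bicollarPiece] at this ⊢
  exact this

/-- **`cVδ Vδ` is stable under the sliver twist of `δ⁻¹`** when `Vδ` is stable under that of `δ_rot⁻¹`. [folklore] -/
theorem sliverTwist_farDehn_symm_mem_cVδ {Vδ : TopologicalSpace.Opens (ThreeTorus × ↥mappingTorusPieceTwo)}
    (hVg : ∀ b ∈ Vδ, sliverTwist (rotDehn hτ hτ').symm b ∈ Vδ)
    (b : ThreeTorus × ↥mappingTorusPieceTwo) (hb : b ∈ cVδ Vδ) : sliverTwist (farDehn hτ hτ').symm b ∈ cVδ Vδ := by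
  by_cases h1 : 1 < (b.2 : ℝ)
  · rw [sliverTwist_of_one_lt _ h1]
    refine ⟨?_, ?_⟩
    · have h2 := hVg _ hb.1
      rw [sliverTwist_of_one_lt _ (show (1 : ℝ) < ((((torusDiffeomorph shearC).symm b.1, b.2) : ThreeTorus ×
        ↥mappingTorusPieceTwo).2 : ℝ) from h1)] at h2
      show ((torusDiffeomorph shearC).symm ((farDehn hτ hτ').symm b.1), b.2) ∈ Vδ
      rw [torusDiffeomorph_shearC_symm_farDehn_symm]
      exact h2
    · show (((farDehn hτ hτ').symm b.1).2.1 : ℂ).re < 0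
      rw [coe_farDehn_symm, torusTwist_snd_fst]
      exact hb.2
  · rw [sliverTwist_of_le_one _ (not_lt.1 h1)]
    exact hb

variable {ε : ℝ} (hε : 0 < ε) (hεR : ε ≤ radialR shearC cPath) (hε2 : ε ≤ 1 / 2)
  {η : ℝ} (hη : 0 < η) {r : ℝ} (hεr : ε < r) (hrπ : r ≤ π)
  (Vδ : TopologicalSpace.Opens (ThreeTorus × ↥mappingTorusPieceTwo))
  (hV1 : ∀ b ∈ Vδ, b.1 ≠ 1) (hVη : ∀ b ∈ Vδ, b ∈ bicollarPiece η)

include hεR in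
/-- `ε ≤ π`. [folklore] -/
theorem le_pi_of_le_radialR : ε ≤ π :=
  hεR.trans ((radialR_le shearC cPath).trans (by
    have := radialRho_le shearC cPath; linarith [Real.pi_pos]))

include hεR in
/-- `𝔏` is the identity on `expT (B(0, ε))`. [folklore] -/
theorem modelMonodromy_expT_of_lt (v : 𝔼 3) (hv : ‖v‖ < ε) : modelMonodromy (expT v) = expT v :=
  modelMonodromy_expT v fun i ↦
    lt_of_le_of_lt ((Real.norm_eq_abs _).symm.le.trans (PiLp.norm_apply_le v i))
      (hv.trans_le (hεR.trans ((radialR_le shearC cPath).trans (by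
        have := radialRho_le shearC cPath; linarith [Real.pi_lt_d2]))))

include hε2 in
/-- `C 𝔏 C⁻¹` is the identity on `expT (B(0, ε))`. [folklore] -/
theorem conjModelMonodromy_expT_of_lt (v : 𝔼 3) (hv : ‖v‖ < ε) : conjModelMonodromy (expT v) = expT v :=
  conjModelMonodromy_expT_of_norm_lt v (hv.trans_le hε2)

set_option maxHeartbeats 800000 in
include hη hεr hVη in
/-- **Conjugating twisting data of the shear model by `C`.** Twisting data for
`(𝔏, δ_rot, farSupport τ, V_δ)` on the product-framed surgery of radius `ε ≤ R_C` of `X_𝔏`, the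
identity off a closed subset of the surgered `twistNbhd 𝔏 η (axisTube r)`, give twisting data for
`(C 𝔏 C⁻¹, δ, farSupport τ, cVδ V_δ)` at the same radius, the identity off a closed subset of the
surgered `twistNbhd (C 𝔏 C⁻¹) η (axisTube r)` (`exists_twistingDiffeo_conjTransfer` with `h = h_C`). [cite: GompfAGT2010, §3 ¶1 and Thm 2.1 (proof, last paragraph)] -/
theorem exists_twistingDiffeo_shearC
    (G : ↥((prodTube modelMonodromy ε hε (le_pi_of_le_radialR hεR) (modelMonodromy_expT_of_lt hεR)).localOpens
        (prodSliverCompl modelMonodromy (isClosed_farSupport τ))) ≃ₘ⟮𝓡 4, 𝓡 4⟯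
      ↥((prodTube modelMonodromy ε hε (le_pi_of_le_radialR hεR) (modelMonodromy_expT_of_lt hεR)).localOpens
        (prodSliverCompl modelMonodromy (isClosed_farSupport τ))))
    (hG : ∀ (x : ↥((prodTube modelMonodromy ε hε (le_pi_of_le_radialR hεR) (modelMonodromy_expT_of_lt hεR)).localOpens
        (prodSliverCompl modelMonodromy (isClosed_farSupport τ)))) (b : ↥Vδ),
      (b : ThreeTorus × ↥mappingTorusPieceTwo) ∉ fibreSliver (farSupport τ) →
        (x : prodSurgered modelMonodromy ε hε (le_pi_of_le_radialR hεR) (modelMonodromy_expT_of_lt hεR)) =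
          (prodTube modelMonodromy ε hε (le_pi_of_le_radialR hεR) (modelMonodromy_expT_of_lt hεR)).glueData.inl
          (opensToComplement (prodTube modelMonodromy ε hε (le_pi_of_le_radialR hεR) (modelMonodromy_expT_of_lt hεR))
            (mtGlueData modelMonodromy).inr Vδ
            (inr_not_mem_range_secCircle_self modelMonodromy hε (le_pi_of_le_radialR hεR)
              (modelMonodromy_expT_of_lt hεR) Vδ hV1) b) →
          ∃ a' : ↥(prodTube modelMonodromy ε hε (le_pi_of_le_radialR hεR) (modelMonodromy_expT_of_lt hεR)).complement,
            (a' : MTorus modelMonodromy) = (mtGlueData modelMonodromy).inr (sliverTwist (rotDehn hτ hτ') b) ∧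
              (G x : prodSurgered modelMonodromy ε hε (le_pi_of_le_radialR hεR) (modelMonodromy_expT_of_lt hεR)) =
                (prodTube modelMonodromy ε hε (le_pi_of_le_radialR hεR) (modelMonodromy_expT_of_lt hεR)).glueData.inl a')
    (Ksupp : Set (prodSurgered modelMonodromy ε hε (le_pi_of_le_radialR hεR) (modelMonodromy_expT_of_lt hεR)))
    (hKc : IsClosed Ksupp)
    (hKU : Ksupp ⊆ (prodTube modelMonodromy ε hε (le_pi_of_le_radialR hεR) (modelMonodromy_expT_of_lt hεR)).localOpens
      (twistNbhd modelMonodromy η (axisTube hrπ) (Diffeotopy.refl 𝓣 ThreeTorus) (Diffeomorph.refl 𝓣 ThreeTorus ∞)))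
    (hGK : ∀ x : ↥((prodTube modelMonodromy ε hε (le_pi_of_le_radialR hεR) (modelMonodromy_expT_of_lt hεR)).localOpens
        (prodSliverCompl modelMonodromy (isClosed_farSupport τ))),
      (x : prodSurgered modelMonodromy ε hε (le_pi_of_le_radialR hεR) (modelMonodromy_expT_of_lt hεR)) ∉ Ksupp →
        G x = x) :
    ∃ (G' : ↥((prodTube conjModelMonodromy ε hε (le_pi_of_le_radialR hεR) (conjModelMonodromy_expT_of_lt hε2)).localOpens
          (prodSliverCompl conjModelMonodromy (isClosed_farSupport τ))) ≃ₘ⟮𝓡 4, 𝓡 4⟯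
        ↥((prodTube conjModelMonodromy ε hε (le_pi_of_le_radialR hεR) (conjModelMonodromy_expT_of_lt hε2)).localOpens
          (prodSliverCompl conjModelMonodromy (isClosed_farSupport τ))))
      (Ksupp' : Set (prodSurgered conjModelMonodromy ε hε (le_pi_of_le_radialR hεR) (conjModelMonodromy_expT_of_lt hε2))),
      IsClosed Ksupp' ∧
      Ksupp' ⊆ (prodTube conjModelMonodromy ε hε (le_pi_of_le_radialR hεR) (conjModelMonodromy_expT_of_lt hε2)).localOpens
        (twistNbhd conjModelMonodromy η (axisTube hrπ) (Diffeotopy.refl 𝓣 ThreeTorus) (Diffeomorph.refl 𝓣 ThreeTorus ∞)) ∧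
      (∀ x : ↥((prodTube conjModelMonodromy ε hε (le_pi_of_le_radialR hεR) (conjModelMonodromy_expT_of_lt hε2)).localOpens
          (prodSliverCompl conjModelMonodromy (isClosed_farSupport τ))),
        (x : prodSurgered conjModelMonodromy ε hε (le_pi_of_le_radialR hεR) (conjModelMonodromy_expT_of_lt hε2)) ∉ Ksupp' →
          G' x = x) ∧
      ∀ (x : ↥((prodTube conjModelMonodromy ε hε (le_pi_of_le_radialR hεR) (conjModelMonodromy_expT_of_lt hε2)).localOpens
          (prodSliverCompl conjModelMonodromy (isClosed_farSupport τ)))) (b : ↥(cVδ Vδ)),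
        (b : ThreeTorus × ↥mappingTorusPieceTwo) ∉ fibreSliver (farSupport τ) →
          (x : prodSurgered conjModelMonodromy ε hε (le_pi_of_le_radialR hεR) (conjModelMonodromy_expT_of_lt hε2)) =
            (prodTube conjModelMonodromy ε hε (le_pi_of_le_radialR hεR) (conjModelMonodromy_expT_of_lt hε2)).glueData.inl
            (opensToComplement (prodTube conjModelMonodromy ε hε (le_pi_of_le_radialR hεR) (conjModelMonodromy_expT_of_lt hε2))
              (mtGlueData conjModelMonodromy).inr (cVδ Vδ)
              (inr_not_mem_range_secCircle_self conjModelMonodromy hε (le_pi_of_le_radialR hεR)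
                (conjModelMonodromy_expT_of_lt hε2) (cVδ Vδ) (cVδ_fst_ne_one hV1)) b) →
            ∃ a' : ↥(prodTube conjModelMonodromy ε hε (le_pi_of_le_radialR hεR) (conjModelMonodromy_expT_of_lt hε2)).complement,
              (a' : MTorus conjModelMonodromy) = (mtGlueData conjModelMonodromy).inr (sliverTwist (farDehn hτ hτ') b) ∧
                (G' x : prodSurgered conjModelMonodromy ε hε (le_pi_of_le_radialR hεR) (conjModelMonodromy_expT_of_lt hε2)) =
                  (prodTube conjModelMonodromy ε hε (le_pi_of_le_radialR hεR) (conjModelMonodromy_expT_of_lt hε2)).glueData.inl a' := by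
  have hh : ∀ w : 𝔼 3, hC (expT ((TubeTwist.const ε hε (le_pi_of_le_radialR hεR)).shrink w)) =
      expT ((TubeTwist.const ε hε (le_pi_of_le_radialR hεR)).shrink w) :=
    fun w ↦ hC_expT ((TubeTwist.norm_shrink_const_lt hε (le_pi_of_le_radialR hεR) w).trans_le hεR)
  have hVV' : ∀ y ∈ axisTube hrπ, hC y ∈ axisTube hrπ := by
    intro y hy
    rw [mem_axisTube_iff] at hy ⊢
    rw [show (hC y).2.1 = y.2.1 from congrArg Prod.fst (hC_snd y), show (hC y).2.2 = y.2.2 from congrArg Prod.snd (hC_snd y)]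
    exact hy
  have hVε : ∀ v : 𝔼 3, ‖v‖ < ε → expT v ∈ axisTube hrπ := fun v hv ↦ expT_mem_axisTube hrπ (hv.trans hεr)
  have hSS' : ∀ y, y ∈ farSupport τ ↔ hC y ∈ farSupport τ := by
    intro y
    simp only [farSupport, mem_setOf_eq]
    rw [show (hC y).2.1 = y.2.1 from congrArg Prod.fst (hC_snd y)]
  have hSε : ∀ v : 𝔼 3, ‖v‖ < ε → expT v ∉ farSupport τ := fun v hv ↦
    expT_not_mem_farSupport hτ (lt_of_le_of_lt ((Real.norm_eq_abs _).symm.le.trans (PiLp.norm_apply_le v 1))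
      (hv.trans_le (hε2.trans (by linarith [Real.pi_gt_three]))))
  have hVδ : ∀ b' ∈ cVδ Vδ, (hC.symm b'.1, b'.2) ∈ Vδ := by
    intro b' hb'
    rw [hC_symm_apply_of_re_neg hb'.2]
    exact hb'.1
  exact exists_twistingDiffeo_conjTransfer modelMonodromy conjModelMonodromy hC hC_conj hε (le_pi_of_le_radialR hεR)
    (modelMonodromy_expT_of_lt hεR) hε (le_pi_of_le_radialR hεR) (conjModelMonodromy_expT_of_lt hε2) hh hη
    (axisTube hrπ) (axisTube hrπ) hVV' hVε (rotDehn hτ hτ') (farDehn hτ hτ') (hC_rotDehn hτ hτ')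
    (isClosed_farSupport τ) (isClosed_farSupport τ) hSS' hSε hSε Vδ (cVδ Vδ) hV1 (cVδ_fst_ne_one hV1) hVη hVδ
    G hG Ksupp hKc hKU hGK

end ShearC


/-! ### A standard neighbourhood of the sliver -/

section SliverNbhd

/-- **The standard neighbourhood `{re z₂ < 0} × (1 - η', 1 + η')` of the far sliver** in the second
cylinder. [folklore] -/
def sliverNbhd (η' : ℝ) : TopologicalSpace.Opens (ThreeTorus × ↥mappingTorusPieceTwo) :=
  ⟨{b | ((b.1.2.1 : Circle) : ℂ).re < 0 ∧ b ∈ bicollarPiece η'},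
    (isOpen_lt ((Complex.continuous_re.comp continuous_subtype_val).comp
      (continuous_fst.comp (continuous_snd.comp continuous_fst))) continuous_const).inter (bicollarPiece η').2⟩

/-- Membership in `sliverNbhd`. [folklore] -/
@[simp] theorem mem_sliverNbhd {η' : ℝ} {b : ThreeTorus × ↥mappingTorusPieceTwo} :
    b ∈ sliverNbhd η' ↔ ((b.1.2.1 : Circle) : ℂ).re < 0 ∧ b ∈ bicollarPiece η' := Iff.rfl

variable {τ : ℝ} (hτ : 0 < τ) (hτ' : τ < π / 2) {η' : ℝ} (hη' : 0 < η')

include hτ hτ' hη' in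
/-- The standard neighbourhood contains the far sliver. [folklore] -/
theorem fibreSliver_subset_sliverNbhd : fibreSliver (farSupport τ) ⊆ sliverNbhd η' := by
  intro b hb
  obtain ⟨hb1, hb2⟩ := (mem_fibreSliver_iff).1 hb
  refine ⟨re_neg_of_mem_farSupport hτ hτ' hb1, ?_⟩
  rw [mem_bicollarPiece, hb2]
  constructor <;> linarith

/-- The standard neighbourhood misses the fibre through `1`. [folklore] -/
theorem sliverNbhd_fst_ne_one (η' : ℝ) (b : ThreeTorus × ↥mappingTorusPieceTwo) (hb : b ∈ sliverNbhd η') :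
    b.1 ≠ 1 := by
  intro h1
  have h := hb.1
  rw [h1] at h
  exact absurd h (by norm_num : ¬ ((((1 : ThreeTorus).2.1 : Circle) : ℂ).re < 0))

/-- The standard neighbourhood is stable under the sliver twist of any map preserving `z₂`. [folklore] -/
theorem sliverTwist_mem_sliverNbhd {η' : ℝ} {g : ThreeTorus → ThreeTorus} (hg2 : ∀ y, (g y).2.1 = y.2.1)
    (b : ThreeTorus × ↥mappingTorusPieceTwo) (hb : b ∈ sliverNbhd η') : sliverTwist g b ∈ sliverNbhd η' := by
  by_cases h1 : 1 < (b.2 : ℝ)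
  · rw [sliverTwist_of_one_lt g h1]
    refine ⟨by rw [hg2]; exact hb.1, ?_⟩
    have h := hb.2
    rw [mem_bicollarPiece] at h ⊢
    exact h
  · rw [sliverTwist_of_le_one g (not_lt.1 h1)]; exact hb

/-- The standard neighbourhood of width `η' ≤ η` lies in the bicollar piece of width `η`. [folklore] -/
theorem sliverNbhd_subset_bicollar {η' η : ℝ} (hle : η' ≤ η) (b : ThreeTorus × ↥mappingTorusPieceTwo)
    (hb : b ∈ sliverNbhd η') : b ∈ bicollarPiece η := by
  have h := hb.2
  rw [mem_bicollarPiece] at h ⊢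
  constructor <;> linarith [h.1, h.2]

end SliverNbhd

/-! ### F from twisting data in the shear model -/

section Assembly

/-- `ε₀ = modelStraightening.prodRad < 1/3` (the Gompf tube has radius `≤ π/10`). [folklore] -/
theorem Straightening.prodRad_lt_third {A : Matrix.SpecialLinearGroup (Fin 3) ℤ} (S : Straightening A) :
    S.prodRad < 1 / 3 := by
  have h1 : S.prodRad ≤ S.scale * twistRadius A S.path :=
    mul_le_of_le_one_left (mul_pos S.scale_pos (twistRadius_pos A S.path)).le (straightenScale'_le_one A)
  have h2 : S.scale * twistRadius A S.path ≤ twistRadius A S.path :=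
    mul_le_of_le_one_left (twistRadius_pos A S.path).le S.scale_le_one
  have h3 : twistRadius A S.path ≤ π / 10 := by
    have hK := three_le_twistBound A S.path
    rw [twistRadius, div_le_div_iff₀ (by linarith) (by norm_num : (0 : ℝ) < 10)]
    nlinarith [Real.pi_pos]
  linarith [Real.pi_lt_d2]

/-- `𝔏` is the identity on `expT (B̄(0, 8ε₀/7))`, `ε₀ = modelStraightening.prodRad`. [folklore] -/
theorem modelMonodromy_expT_of_le (v : 𝔼 3) (hv : ‖v‖ ≤ contractScale modelStraightening.prodRad * 4) :
    modelMonodromy (expT v) = expT v :=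
  modelMonodromy_expT v fun i ↦
    lt_of_le_of_lt ((Real.norm_eq_abs _).symm.le.trans (PiLp.norm_apply_le v i))
      (hv.trans_lt (by have := modelStraightening.prodRad_lt_third; unfold contractScale; linarith))

set_option maxHeartbeats 1600000 in
/-- **F from fishtail twisting data in the shear model** (Gompf's Theorem 2.1, framed form, reduced to
Lemma 2.2 in `X_𝔏`). Suppose that for every thickness `0 < r ≤ r₀` (some `r₀ ≤ π`) there are a parameter
`0 < τ < π/2`, a bicollar width `η > 0`, an open neighbourhood `V_δ ⊆ T³ × (1 - η, 1 + η)` of the fibre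
sliver `farSupport τ × {1}` missing the fibre through `1` and stable under the sliver twist of
`δ_rot⁻¹`, and a diffeomorphism `G` of the shear model `modelSphere = X_𝔏` surgered (radius
`ε₀ = modelStraightening.prodRad`) minus the sliver, **twisting by `δ_rot` across the sliver on `V_δ`**
(hypotheses of `nonempty_diffeomorph_prodSurgered_of_twistingDiffeo`) and **the identity off a closed
subset of the surgered twisted cylinder neighbourhood `twistNbhd 𝔏 η (axisTube r)`** (Gompf's fishtail
neighbourhood `N ∪ (2-handle)` with a thin handle). Then F holds: reduce the radius
(`exists_twistingDiffeo_radius`), conjugate by `C` (`exists_twistingDiffeo_shearC`) and apply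
`gompf2010_framedTwist_of_conjModel`. [cite: GompfAGT2010, Thm 2.1 (proof), Lemma 2.2, §3 ¶1, §4 ¶3] -/
theorem gompf2010_framedTwist_of_shearModel {r₀ : ℝ} (hr₀ : 0 < r₀) (hr₀π : r₀ ≤ π)
    (hdata : ∀ (r : ℝ) (_ : 0 < r) (hrr₀ : r ≤ r₀),
      ∃ (τ : ℝ) (hτ : 0 < τ) (hτ' : τ < π / 2) (η : ℝ) (_ : 0 < η)
        (Vδ : TopologicalSpace.Opens (ThreeTorus × ↥mappingTorusPieceTwo))
        (_ : fibreSliver (farSupport τ) ⊆ Vδ) (hV1 : ∀ b ∈ Vδ, b.1 ≠ 1)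
        (_ : ∀ b ∈ Vδ, sliverTwist (rotDehn hτ hτ').symm b ∈ Vδ) (_ : ∀ b ∈ Vδ, b ∈ bicollarPiece η)
        (G : ↥((prodTube modelMonodromy modelStraightening.prodRad modelStraightening.prodRad_pos
            modelStraightening.prodRad_le_pi modelStraightening.monodromy_expT_of_norm_lt).localOpens
            (prodSliverCompl modelMonodromy (isClosed_farSupport τ))) ≃ₘ⟮𝓡 4, 𝓡 4⟯
          ↥((prodTube modelMonodromy modelStraightening.prodRad modelStraightening.prodRad_pos
            modelStraightening.prodRad_le_pi modelStraightening.monodromy_expT_of_norm_lt).localOpens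
            (prodSliverCompl modelMonodromy (isClosed_farSupport τ))))
        (Ksupp : Set modelSphere),
        (∀ (x : ↥((prodTube modelMonodromy modelStraightening.prodRad modelStraightening.prodRad_pos
              modelStraightening.prodRad_le_pi modelStraightening.monodromy_expT_of_norm_lt).localOpens
              (prodSliverCompl modelMonodromy (isClosed_farSupport τ))))
            (b : ↥Vδ), (b : ThreeTorus × ↥mappingTorusPieceTwo) ∉ fibreSliver (farSupport τ) →
            (x : modelSphere) =
              (prodTube modelMonodromy modelStraightening.prodRad modelStraightening.prodRad_pos
                modelStraightening.prodRad_le_pi modelStraightening.monodromy_expT_of_norm_lt).glueData.inl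
                (opensToComplement (prodTube modelMonodromy modelStraightening.prodRad modelStraightening.prodRad_pos
                  modelStraightening.prodRad_le_pi modelStraightening.monodromy_expT_of_norm_lt)
                  (mtGlueData modelMonodromy).inr Vδ
                  (inr_not_mem_range_secCircle_self modelMonodromy modelStraightening.prodRad_pos
                    modelStraightening.prodRad_le_pi modelStraightening.monodromy_expT_of_norm_lt Vδ hV1) b) →
            ∃ a' : ↥(prodTube modelMonodromy modelStraightening.prodRad modelStraightening.prodRad_pos
                modelStraightening.prodRad_le_pi modelStraightening.monodromy_expT_of_norm_lt).complement,
              (a' : MTorus modelMonodromy) = (mtGlueData modelMonodromy).inr (sliverTwist (rotDehn hτ hτ') b) ∧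
                (G x : modelSphere) =
                  (prodTube modelMonodromy modelStraightening.prodRad modelStraightening.prodRad_pos
                    modelStraightening.prodRad_le_pi modelStraightening.monodromy_expT_of_norm_lt).glueData.inl a') ∧
        IsClosed Ksupp ∧
        Ksupp ⊆ (prodTube modelMonodromy modelStraightening.prodRad modelStraightening.prodRad_pos
          modelStraightening.prodRad_le_pi modelStraightening.monodromy_expT_of_norm_lt).localOpens
          (twistNbhd modelMonodromy η (axisTube (hrr₀.trans hr₀π)) (Diffeotopy.refl 𝓣 ThreeTorus)
            (Diffeomorph.refl 𝓣 ThreeTorus ∞)) ∧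
        ∀ x : ↥((prodTube modelMonodromy modelStraightening.prodRad modelStraightening.prodRad_pos
            modelStraightening.prodRad_le_pi modelStraightening.monodromy_expT_of_norm_lt).localOpens
            (prodSliverCompl modelMonodromy (isClosed_farSupport τ))),
          (x : modelSphere) ∉ Ksupp → G x = x) :
    gompf2010_framedTwist := by
  refine gompf2010_framedTwist_of_conjModel fun r hr hrr ↦ ?_
  have hrπ : r ≤ π := hrr.trans one_lt_pi'.le
  -- the data at thickness `min r r₀`, its support read in `twistNbhd 𝔏 η (axisTube r)`
  obtain ⟨τ, hτ, hτ', η, hη, Vδ, hVS, hV1, hVg, hVη, G, Ksupp, hG, hKc, hKU', hGK⟩ :=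
    hdata (min r r₀) (lt_min hr hr₀) (min_le_right _ _)
  have hKU : Ksupp ⊆ (prodTube modelMonodromy modelStraightening.prodRad modelStraightening.prodRad_pos
      modelStraightening.prodRad_le_pi modelStraightening.monodromy_expT_of_norm_lt).localOpens
      (twistNbhd modelMonodromy η (axisTube hrπ) (Diffeotopy.refl 𝓣 ThreeTorus) (Diffeomorph.refl 𝓣 ThreeTorus ∞)) :=
    fun p hp ↦ CircleNbhd.localOpens_mono _ (fun x hx ↦ twistNbhd_mono modelMonodromy η (fun y hy ↦ by
      rw [mem_axisTube_iff] at hy ⊢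
      exact ⟨hy.1.trans_le (min_le_left _ _), hy.2.trans_le (min_le_left _ _)⟩) _ _ hx) (hKU' hp)
  -- the radii
  have hε₀ := modelStraightening.prodRad_pos
  have hε₀' : modelStraightening.prodRad < 1 / 3 := modelStraightening.prodRad_lt_third
  have hR := radialR_pos shearC cPath
  obtain ⟨ε, hε, hεr2, hεR, hεε₀, hε2⟩ : ∃ ε : ℝ, 0 < ε ∧ ε ≤ r / 2 ∧ ε ≤ radialR shearC cPath ∧
      ε ≤ modelStraightening.prodRad ∧ ε ≤ 1 / 2 :=
    ⟨min (r / 2) (min (radialR shearC cPath) (min modelStraightening.prodRad (1 / 2))),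
      lt_min (by linarith) (lt_min hR (lt_min hε₀ (by norm_num))), min_le_left _ _,
      (min_le_right _ _).trans (min_le_left _ _),
      (min_le_right _ _).trans ((min_le_right _ _).trans (min_le_left _ _)),
      (min_le_right _ _).trans ((min_le_right _ _).trans (min_le_right _ _))⟩
  have hεr : ε < r := by linarith
  -- radius reduction `ε₀ ↦ ε`
  have hrad := exists_twistingDiffeo_radius modelMonodromy hε₀ hε₀' hε hεε₀ modelMonodromy_expT_of_le hτ hτ' hη
    hεr hrπ Vδ hV1 hVη G hG Ksupp hKc hKU hGK
  obtain ⟨G₁, K₁, hK₁c, hK₁U, hG₁K, hG₁⟩ := hrad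
  -- conjugation by `C`
  have hconjC := exists_twistingDiffeo_shearC hτ hτ' hε hεR hε2 hη hεr hrπ (negVδ Vδ) (negVδ_fst_ne_one Vδ hV1)
    (fun b hb ↦ hVη b hb.1) G₁ hG₁ K₁ hK₁c hK₁U hG₁K
  obtain ⟨G₂, K₂, hK₂c, hK₂U, hG₂K, hG₂⟩ := hconjC
  refine ⟨ε, hε, le_pi_of_le_radialR hεR, hεr2, by linarith, conjModelMonodromy_expT_of_lt hε2, τ, hτ, hτ', η, hη,
    cVδ (negVδ Vδ), fibreSliver_subset_cVδ hτ hτ' (fibreSliver_subset_negVδ hτ hτ' hVS),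
    cVδ_fst_ne_one (negVδ_fst_ne_one Vδ hV1), fun b hb ↦ ?_, cVδ_subset_bicollar (fun b hb ↦ hVη b hb.1),
    G₂, K₂, hG₂, hK₂c, hK₂U, hG₂K⟩
  exact sliverTwist_farDehn_symm_mem_cVδ hτ hτ'
    (fun b hb ↦ sliverTwist_mem_negVδ (g := ⇑(rotDehn hτ hτ').symm) (fun y ↦ rfl) hVg hb) b hb

set_option maxHeartbeats 1600000 in
/-- **F from fishtail twisting data in the shear model, with the standard sliver neighbourhood**
`sliverNbhd η' = {re z₂ < 0} × (1 - η', 1 + η')` (any `0 < η' ≤ η`) as the region where `G` twists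
by `δ_rot` across the sliver. [cite: GompfAGT2010, Thm 2.1 (proof), Lemma 2.2] -/
theorem gompf2010_framedTwist_of_shearModel' {r₀ : ℝ} (hr₀ : 0 < r₀) (hr₀π : r₀ ≤ π)
    (hdata : ∀ (r : ℝ) (_ : 0 < r) (hrr₀ : r ≤ r₀),
      ∃ (τ : ℝ) (hτ : 0 < τ) (hτ' : τ < π / 2) (η : ℝ) (_ : 0 < η) (η' : ℝ) (_ : 0 < η') (_ : η' ≤ η)
        (G : ↥((prodTube modelMonodromy modelStraightening.prodRad modelStraightening.prodRad_pos
            modelStraightening.prodRad_le_pi modelStraightening.monodromy_expT_of_norm_lt).localOpens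
            (prodSliverCompl modelMonodromy (isClosed_farSupport τ))) ≃ₘ⟮𝓡 4, 𝓡 4⟯
          ↥((prodTube modelMonodromy modelStraightening.prodRad modelStraightening.prodRad_pos
            modelStraightening.prodRad_le_pi modelStraightening.monodromy_expT_of_norm_lt).localOpens
            (prodSliverCompl modelMonodromy (isClosed_farSupport τ))))
        (Ksupp : Set modelSphere),
        (∀ (x : ↥((prodTube modelMonodromy modelStraightening.prodRad modelStraightening.prodRad_pos
              modelStraightening.prodRad_le_pi modelStraightening.monodromy_expT_of_norm_lt).localOpens
              (prodSliverCompl modelMonodromy (isClosed_farSupport τ))))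
            (b : ↥(sliverNbhd η')), (b : ThreeTorus × ↥mappingTorusPieceTwo) ∉ fibreSliver (farSupport τ) →
            (x : modelSphere) =
              (prodTube modelMonodromy modelStraightening.prodRad modelStraightening.prodRad_pos
                modelStraightening.prodRad_le_pi modelStraightening.monodromy_expT_of_norm_lt).glueData.inl
                (opensToComplement (prodTube modelMonodromy modelStraightening.prodRad modelStraightening.prodRad_pos
                  modelStraightening.prodRad_le_pi modelStraightening.monodromy_expT_of_norm_lt)
                  (mtGlueData modelMonodromy).inr (sliverNbhd η')
                  (inr_not_mem_range_secCircle_self modelMonodromy modelStraightening.prodRad_pos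
                    modelStraightening.prodRad_le_pi modelStraightening.monodromy_expT_of_norm_lt (sliverNbhd η')
                    (sliverNbhd_fst_ne_one η')) b) →
            ∃ a' : ↥(prodTube modelMonodromy modelStraightening.prodRad modelStraightening.prodRad_pos
                modelStraightening.prodRad_le_pi modelStraightening.monodromy_expT_of_norm_lt).complement,
              (a' : MTorus modelMonodromy) = (mtGlueData modelMonodromy).inr (sliverTwist (rotDehn hτ hτ') b) ∧
                (G x : modelSphere) =
                  (prodTube modelMonodromy modelStraightening.prodRad modelStraightening.prodRad_pos
                    modelStraightening.prodRad_le_pi modelStraightening.monodromy_expT_of_norm_lt).glueData.inl a') ∧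
        IsClosed Ksupp ∧
        Ksupp ⊆ (prodTube modelMonodromy modelStraightening.prodRad modelStraightening.prodRad_pos
          modelStraightening.prodRad_le_pi modelStraightening.monodromy_expT_of_norm_lt).localOpens
          (twistNbhd modelMonodromy η (axisTube (hrr₀.trans hr₀π)) (Diffeotopy.refl 𝓣 ThreeTorus)
            (Diffeomorph.refl 𝓣 ThreeTorus ∞)) ∧
        ∀ x : ↥((prodTube modelMonodromy modelStraightening.prodRad modelStraightening.prodRad_pos
            modelStraightening.prodRad_le_pi modelStraightening.monodromy_expT_of_norm_lt).localOpens
            (prodSliverCompl modelMonodromy (isClosed_farSupport τ))),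
          (x : modelSphere) ∉ Ksupp → G x = x) :
    gompf2010_framedTwist := by
  refine gompf2010_framedTwist_of_shearModel hr₀ hr₀π fun r hr hrr₀ ↦ ?_
  obtain ⟨τ, hτ, hτ', η, hη, η', hη', hle, G, Ksupp, hG, hKc, hKU, hGK⟩ := hdata r hr hrr₀
  exact ⟨τ, hτ, hτ', η, hη, sliverNbhd η', fibreSliver_subset_sliverNbhd hτ hτ' hη', sliverNbhd_fst_ne_one η',
    fun b hb ↦ sliverTwist_mem_sliverNbhd (g := ⇑(rotDehn hτ hτ').symm) (fun y ↦ rfl) b hb,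
    fun b hb ↦ sliverNbhd_subset_bicollar hle b hb,
    G, Ksupp, hG, hKc, hKU, hGK⟩

end Assembly

end Literature.Topology.FourManifolds
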